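import Summits.QuantumFields.YangMills.Theorems.FluctuationComparisonRegPrIntLS2BetaChartReadSecondOrder
import HarnessLib

/-!
# S2β · (β-4) THE ONE-STEP DERIVATIVE IS LIPSCHITZ ALONG THE CHART: `‖↑((Dψ_{U₀}(A′) X) c) − ↑((Dψ_{U₀}(0) X) c)‖ ≤ (691200∕ρ)·ℓ²·‖A′‖·‖X‖` — [Balaban1985Averaging] PROP. 4
# (148)–(149) «|δC_j(U₀, A)∕δA| ≤ C₃·…» AT ONE STEP, FOR THE TREE's CHART-READ (0.4) EML AVERAGE, BY CAUCHY ON THE POLYDISC OF (β-1)∕(β-2) (read on the real slice at a point `A′ ≠ 0`)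

Cell `ym3-torus` (YM ladder rung R3 = continuum `SU(2)` Yang–Mills on the three-torus at fixed lattice data — a RUNG: NOT d = 4, NOT infinite volume, NOT a mass gap,
NOT Clay).  Width seat `ym3-torus-px13` (gen 26); crux `stmt-QuantumFields-20520`, LINE g18-1 S2β, pairing lane; AVG₂♭-ax_q route (UV3-NODE §89 (px5 g22)): §89.5 «print controls
`U ↦ DQ_k(U)` LIPSCHITZ along the chord … which is AVG₂♭'s content since `DM(U₀)ξ = −R₂ = −∫₀¹ (DM(U_t) − DM(U₀))ξ dt` on the fibre» — THIS FILE is the ONE-STEP Lipschitz letter in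
the SAME chart (derivative of `ψ_{U₀}` at the point `A′` vs at `0`), sequel of (β-3) ✓`…ChartReadSecondOrder` §3 (the complex form).  `--kind proof --supports stmt-QuantumFields-20520
--as helper`, count-neutral, DEFINITION-FREE.

WHAT IS PROVED (sorry-free; objects and hypotheses as (β-1)–(β-3): `0 < ρ ≤ innerRadius` (`= 1∕3` for `SU(2)`), loop guard `dist1 (loopHol U₀ c i) ≤ α` at every coarse bond, `4α ≤ ρ`,
`ℓ = (d+2)L`; `ψ_{U₀}(A)(c) = Λ(Ū(Θ^B(A)·U₀)(c)·Ū(U₀)(c)⁻¹)`).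
* §1 ★★`differentiableAt_chartRead_of_polydisc` — `ψ_{U₀}` is differentiable at EVERY real point `A′` of the open polydisc `100ℓ(e^{‖A′‖} − 1) < ρ` (not only at `0`: near `A′` the
  matrix of each component IS the analytic `Φ_c ∘ (X ↦ X̂)`, (β-2) ✓`coe_chartRead_eq_cplxChartRead`, read back by a continuous linear retraction onto `𝔰𝔲(N)`);
  ★★★`coe_fderiv_chartRead_apply_eq_at` — **`↑((Dψ_{U₀}(A′) X) c) = DΦ_c(Â′) X̂`** there.
* §2 ★★★`norm_fderiv_chartRead_sub_fderiv_le` (polydisc form): `0 < a`, `100ℓ(e^a − 1) ≤ ρ`, `‖A′‖ ≤ a∕8` ⟹ `‖↑((Dψ_{U₀}(A′) X) c) − ↑((Dψ_{U₀}(0) X) c)‖ ≤ 32·(54ℓ(e^a − 1))·‖X‖·‖A′‖∕a²`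
  ((β-3) ✓`norm_fderiv_cplxChartRead_sub_le` read on the real slice); ★★★`norm_fderiv_chartRead_sub_fderiv_le_of_norm_le` (numeric, `a := ρ∕(200ℓ)`): `‖A′‖ ≤ ρ∕(1600ℓ)` ⟹
  **`≤ (691200∕ρ)·ℓ²·‖A′‖·‖X‖`**; ★★★`norm_fderiv_chartRead_sub_fderiv_le_SU2`: `SU(2)` (`ρ = 1∕3`), guard `α ≤ 1∕12`, `‖A′‖ ≤ 1∕(4800ℓ)` ⟹ **`≤ 2073600·ℓ²·‖A′‖·‖X‖`**.

HONEST.  The one-step (`j = 1`) shape of (148)–(149) for the tree's `ψ` in chart-sup currency, by print's road over landed lit engines; print's `η`-scaling and the `k`-fold induction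
over (127) are NOT here (that is the core's count with Q7's telescope); pair weights, AVG₂♭-ax_q, «MULT♭-ax»∕«CRIT-ax», (D-ax), GAP♯∘ (registry UNTOUCHED), the five REGISTERED stubs,
S2β, crux 20520, 19936, 19200, `YM3TorusSU2` — NOT proved; rung R3 = SU(2) YM₃ on T³ at fixed lattice data — NOT d = 4, NOT infinite volume, NOT a mass gap, NOT Clay; the Yang–Mills
mass gap is NOT proved.  Axioms standard.

References: [Balaban1985Averaging] CMP **98** (1985) Prop. 3 (121)–(123) p.36, Prop. 4 (139)–(149) pp.39–40; [Balaban1987RG1] CMP **109** (1987) (0.4) p.253.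
-/

set_option autoImplicit false

noncomputable section

open scoped Matrix.Norms.L2Operator Topology
open Filter Set Function Metric

namespace Summit.QuantumFields.YangMills.Theorems.FluctuationComparisonRegPrIntLS2BetaChartReadDerivLipschitz

open Literature.MathematicalPhysics.QuantumFieldTheory.Balaban1983to89
open Literature.MathematicalPhysics.QuantumFieldTheory.Balaban1983to89.HaarExponentialChart
open Literature.MathematicalPhysics.QuantumFieldTheory.Balaban1983to89.HaarExponentialChart.IsChartRep
open Literature.MathematicalPhysics.QuantumFieldTheory.Balaban1983to89.BlockAveraging (Small Idx avgFun loopHol off corr)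
open Literature.MathematicalPhysics.QuantumFieldTheory.Balaban1983to89.ExpMeanLog (eml expMeanLogSU deltaSU deltaSU_pos)
open Literature.MathematicalPhysics.QuantumFieldTheory.Balaban1983to89.Node00
open Literature.MathematicalPhysics.QuantumFieldTheory.Balaban1983to89.T4Continuum (walk holAt LStep loopWord)
open MatrixLog (mlog)
open Summit.QuantumFields.YangMills.BalabanUVNodes.N09ChartReadAveragingSmooth
open Summit.QuantumFields.YangMills.Theorems.FluctuationComparisonRegPrIntLS2BetaChartReadCplxExtension
open Summit.QuantumFields.YangMills.Theorems.FluctuationComparisonRegPrIntLS2BetaChartReadCplxAnalytic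
open Summit.QuantumFields.YangMills.Theorems.FluctuationComparisonRegPrIntLS2BetaChartReadSecondOrder

variable {P : Params} {j : ℕ} {N : ℕ} [NeZero N] (U₀ : GaugeField P j (SU N))

/-! ## §1 `ψ_{U₀}` is smooth at every real point of the open polydisc, and its derivative there is the complex one -/

section AtPoint

/-- The open polydisc condition is open: if `100ℓ(e^{‖A′‖} − 1) < ρ` then the non-strict condition holds on a sup-norm ball around `A′`. [folklore] -/
theorem eventually_polydisc {E : Type*} [NormedAddCommGroup E] {ρ : ℝ} (A' : E) (hA' : 100 * ((((P.d + 2) * P.L : ℕ) : ℝ) * (Real.exp ‖A'‖ - 1)) < ρ) :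
    ∀ᶠ Y in 𝓝 A', 100 * ((((P.d + 2) * P.L : ℕ) : ℝ) * (Real.exp ‖Y‖ - 1)) ≤ ρ := by
  have hc : Continuous fun Y : E => 100 * ((((P.d + 2) * P.L : ℕ) : ℝ) * (Real.exp ‖Y‖ - 1)) :=
    continuous_const.mul (continuous_const.mul ((Real.continuous_exp.comp continuous_norm).sub continuous_const))
  exact (hc.continuousAt.eventually (isOpen_Iio.mem_nhds hA')).mono fun Y hY => hY.le

/-- Near a real point `A′` of the open polydisc, the matrix of the `c`-component of `ψ_{U₀}` IS `Φ_c ∘ (X ↦ X̂)` ((β-2) ✓`coe_chartRead_eq_cplxChartRead` on a neighbourhood).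
[cite: Balaban1985Averaging, Prop. 3 (121) p.36] -/
theorem coe_chartRead_eventuallyEq_at (c : PBond P (j + 1)) {α ρ : ℝ} (hρ0 : 0 < ρ) (hρ : ρ ≤ innerRadius (specialUnitaryLogChart (Fin N)))
    (hα : ∀ c i, dist1 (loopHol U₀ c i) ≤ α) (hα4 : 4 * α ≤ ρ)
    (A' : PBond P j → (specialUnitaryLogChart (Fin N)).lie) (hA' : 100 * ((((P.d + 2) * P.L : ℕ) : ℝ) * (Real.exp ‖A'‖ - 1)) < ρ) :
    (fun A : PBond P j → (specialUnitaryLogChart (Fin N)).lie => (((fun (A : PBond P j → (specialUnitaryLogChart (Fin N)).lie) => (isChartRep_specialUnitaryGroup (n := Fin N)).logChart (avgFun (expMeanLogSU (n := Fin N)) (fun b => (isChartRep_specialUnitaryGroup (n := Fin N)).expChart (A b) * U₀ b) c * (avgFun (expMeanLogSU (n := Fin N)) U₀ c)⁻¹)) A : (specialUnitaryLogChart (Fin N)).lie) : Matrix (Fin N) (Fin N) ℂ)) =ᶠ[𝓝 A']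
      fun A => (fun B : PBond P j → Matrix (Fin N) (Fin N) ℂ => mlog (eml (fun i : Idx P => ((walk (emb c.src) (loopWord P.L c.dir (off i.1) i.2.1 i.2.2)).map (fun s : LStep P j => if s.fwd then NormedSpace.exp (B s.bond) * ((U₀ s.bond : SU N) : Matrix (Fin N) (Fin N) ℂ) else star ((U₀ s.bond : SU N) : Matrix (Fin N) (Fin N) ℂ) * NormedSpace.exp (-(B s.bond)))).prod) * ((walk (emb c.src) (List.replicate P.L (c.dir, true))).map (fun s : LStep P j => if s.fwd then NormedSpace.exp (B s.bond) * ((U₀ s.bond : SU N) : Matrix (Fin N) (Fin N) ℂ) else star ((U₀ s.bond : SU N) : Matrix (Fin N) (Fin N) ℂ) * NormedSpace.exp (-(B s.bond)))).prod * star ((avgFun (expMeanLogSU (n := Fin N)) U₀ c : SU N) : Matrix (Fin N) (Fin N) ℂ))) (fun b => ((A b : (specialUnitaryLogChart (Fin N)).lie) : Matrix (Fin N) (Fin N) ℂ)) := by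
  filter_upwards [eventually_polydisc A' hA'] with Y hY
  exact coe_chartRead_eq_cplxChartRead U₀ c hρ (hα c) hα4 hρ0 Y hY

/-- ★★ **`ψ_{U₀}` IS DIFFERENTIABLE AT EVERY REAL POINT OF THE OPEN POLYDISC** (each component's matrix is the analytic `Φ_c` composed with the real-linear inclusion; values in the
finite-dimensional `𝔰𝔲(N)`, read back through a continuous linear retraction `M_N(ℂ) → 𝔰𝔲(N)`). [cite: Balaban1985Averaging, Prop. 3 (121) p.36] -/
theorem differentiableAt_chartRead_of_polydisc {α ρ : ℝ} (hρ0 : 0 < ρ) (hρ : ρ ≤ innerRadius (specialUnitaryLogChart (Fin N)))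
    (hα : ∀ c i, dist1 (loopHol U₀ c i) ≤ α) (hα4 : 4 * α ≤ ρ)
    (A' : PBond P j → (specialUnitaryLogChart (Fin N)).lie) (hA' : 100 * ((((P.d + 2) * P.L : ℕ) : ℝ) * (Real.exp ‖A'‖ - 1)) < ρ) :
    DifferentiableAt ℝ (fun (A : PBond P j → (specialUnitaryLogChart (Fin N)).lie) (c : PBond P (j + 1)) => (isChartRep_specialUnitaryGroup (n := Fin N)).logChart (avgFun (expMeanLogSU (n := Fin N)) (fun b => (isChartRep_specialUnitaryGroup (n := Fin N)).expChart (A b) * U₀ b) c * (avgFun (expMeanLogSU (n := Fin N)) U₀ c)⁻¹)) A' := by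
  set ι : (PBond P j → (specialUnitaryLogChart (Fin N)).lie) →L[ℝ] (PBond P j → Matrix (Fin N) (Fin N) ℂ) :=
    ContinuousLinearMap.pi fun b => ((specialUnitaryLogChart (Fin N)).lie).subtypeL.comp (ContinuousLinearMap.proj b) with hιdef
  have hιapp : ∀ Y : PBond P j → (specialUnitaryLogChart (Fin N)).lie, ι Y = fun b => ((Y b : (specialUnitaryLogChart (Fin N)).lie) : Matrix (Fin N) (Fin N) ℂ) := fun Y => rfl
  have hA'' : 100 * ((((P.d + 2) * P.L : ℕ) : ℝ) * (Real.exp ‖ι A'‖ - 1)) ≤ ρ := by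
    have hmono : Real.exp ‖ι A'‖ - 1 ≤ Real.exp ‖A'‖ - 1 := by rw [hιapp]; linarith [Real.exp_le_exp.2 (norm_coePi_le A')]
    exact le_trans (by gcongr) hA'.le
  refine (differentiableAt_pi (𝕜 := ℝ) (Φ := (fun (A : PBond P j → (specialUnitaryLogChart (Fin N)).lie) (c : PBond P (j + 1)) => (isChartRep_specialUnitaryGroup (n := Fin N)).logChart (avgFun (expMeanLogSU (n := Fin N)) (fun b => (isChartRep_specialUnitaryGroup (n := Fin N)).expChart (A b) * U₀ b) c * (avgFun (expMeanLogSU (n := Fin N)) U₀ c)⁻¹))) (x := A')).2 fun c => ?_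
  obtain ⟨π, hπ⟩ := Submodule.ClosedComplemented.of_finiteDimensional ((specialUnitaryLogChart (Fin N)).lie)
  have hfe : (fun A : PBond P j → (specialUnitaryLogChart (Fin N)).lie => (fun (A : PBond P j → (specialUnitaryLogChart (Fin N)).lie) => (isChartRep_specialUnitaryGroup (n := Fin N)).logChart (avgFun (expMeanLogSU (n := Fin N)) (fun b => (isChartRep_specialUnitaryGroup (n := Fin N)).expChart (A b) * U₀ b) c * (avgFun (expMeanLogSU (n := Fin N)) U₀ c)⁻¹)) A) = fun A => π ((((fun (A : PBond P j → (specialUnitaryLogChart (Fin N)).lie) => (isChartRep_specialUnitaryGroup (n := Fin N)).logChart (avgFun (expMeanLogSU (n := Fin N)) (fun b => (isChartRep_specialUnitaryGroup (n := Fin N)).expChart (A b) * U₀ b) c * (avgFun (expMeanLogSU (n := Fin N)) U₀ c)⁻¹)) A : (specialUnitaryLogChart (Fin N)).lie) : Matrix (Fin N) (Fin N) ℂ)) :=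
    funext fun A => (hπ _).symm
  rw [hfe]
  have hΦ : DifferentiableAt ℂ (fun B : PBond P j → Matrix (Fin N) (Fin N) ℂ => mlog (eml (fun i : Idx P => ((walk (emb c.src) (loopWord P.L c.dir (off i.1) i.2.1 i.2.2)).map (fun s : LStep P j => if s.fwd then NormedSpace.exp (B s.bond) * ((U₀ s.bond : SU N) : Matrix (Fin N) (Fin N) ℂ) else star ((U₀ s.bond : SU N) : Matrix (Fin N) (Fin N) ℂ) * NormedSpace.exp (-(B s.bond)))).prod) * ((walk (emb c.src) (List.replicate P.L (c.dir, true))).map (fun s : LStep P j => if s.fwd then NormedSpace.exp (B s.bond) * ((U₀ s.bond : SU N) : Matrix (Fin N) (Fin N) ℂ) else star ((U₀ s.bond : SU N) : Matrix (Fin N) (Fin N) ℂ) * NormedSpace.exp (-(B s.bond)))).prod * star ((avgFun (expMeanLogSU (n := Fin N)) U₀ c : SU N) : Matrix (Fin N) (Fin N) ℂ))) (ι A') :=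
    (analyticAt_cplxChartRead U₀ c hρ (hα c) hα4 (ι A') hA'').differentiableAt
  have hcomp : DifferentiableAt ℝ (fun A : PBond P j → (specialUnitaryLogChart (Fin N)).lie => (fun B : PBond P j → Matrix (Fin N) (Fin N) ℂ => mlog (eml (fun i : Idx P => ((walk (emb c.src) (loopWord P.L c.dir (off i.1) i.2.1 i.2.2)).map (fun s : LStep P j => if s.fwd then NormedSpace.exp (B s.bond) * ((U₀ s.bond : SU N) : Matrix (Fin N) (Fin N) ℂ) else star ((U₀ s.bond : SU N) : Matrix (Fin N) (Fin N) ℂ) * NormedSpace.exp (-(B s.bond)))).prod) * ((walk (emb c.src) (List.replicate P.L (c.dir, true))).map (fun s : LStep P j => if s.fwd then NormedSpace.exp (B s.bond) * ((U₀ s.bond : SU N) : Matrix (Fin N) (Fin N) ℂ) else star ((U₀ s.bond : SU N) : Matrix (Fin N) (Fin N) ℂ) * NormedSpace.exp (-(B s.bond)))).prod * star ((avgFun (expMeanLogSU (n := Fin N)) U₀ c : SU N) : Matrix (Fin N) (Fin N) ℂ))) (ι A)) A' :=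
    ((hΦ.hasFDerivAt.restrictScalars ℝ).comp A' ι.hasFDerivAt).differentiableAt
  have heq : (fun A : PBond P j → (specialUnitaryLogChart (Fin N)).lie => (((fun (A : PBond P j → (specialUnitaryLogChart (Fin N)).lie) => (isChartRep_specialUnitaryGroup (n := Fin N)).logChart (avgFun (expMeanLogSU (n := Fin N)) (fun b => (isChartRep_specialUnitaryGroup (n := Fin N)).expChart (A b) * U₀ b) c * (avgFun (expMeanLogSU (n := Fin N)) U₀ c)⁻¹)) A : (specialUnitaryLogChart (Fin N)).lie) : Matrix (Fin N) (Fin N) ℂ)) =ᶠ[𝓝 A']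
      fun A => (fun B : PBond P j → Matrix (Fin N) (Fin N) ℂ => mlog (eml (fun i : Idx P => ((walk (emb c.src) (loopWord P.L c.dir (off i.1) i.2.1 i.2.2)).map (fun s : LStep P j => if s.fwd then NormedSpace.exp (B s.bond) * ((U₀ s.bond : SU N) : Matrix (Fin N) (Fin N) ℂ) else star ((U₀ s.bond : SU N) : Matrix (Fin N) (Fin N) ℂ) * NormedSpace.exp (-(B s.bond)))).prod) * ((walk (emb c.src) (List.replicate P.L (c.dir, true))).map (fun s : LStep P j => if s.fwd then NormedSpace.exp (B s.bond) * ((U₀ s.bond : SU N) : Matrix (Fin N) (Fin N) ℂ) else star ((U₀ s.bond : SU N) : Matrix (Fin N) (Fin N) ℂ) * NormedSpace.exp (-(B s.bond)))).prod * star ((avgFun (expMeanLogSU (n := Fin N)) U₀ c : SU N) : Matrix (Fin N) (Fin N) ℂ))) (ι A) := by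
    have h := coe_chartRead_eventuallyEq_at U₀ c hρ0 hρ hα hα4 A' hA'
    simp only [hιapp]
    exact h
  exact π.differentiableAt.comp A' (hcomp.congr_of_eventuallyEq heq)

/-- ★★★ **THE DERIVATIVES AGREE AT EVERY REAL POINT OF THE OPEN POLYDISC**: `↑((Dψ_{U₀}(A′) X) c) = DΦ_c(Â′) X̂`. [cite: Balaban1985Averaging, Prop. 3 (122) p.36, Prop. 4 (148) p.40] -/
theorem coe_fderiv_chartRead_apply_eq_at {α ρ : ℝ} (hρ0 : 0 < ρ) (hρ : ρ ≤ innerRadius (specialUnitaryLogChart (Fin N)))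
    (hα : ∀ c i, dist1 (loopHol U₀ c i) ≤ α) (hα4 : 4 * α ≤ ρ)
    (A' : PBond P j → (specialUnitaryLogChart (Fin N)).lie) (hA' : 100 * ((((P.d + 2) * P.L : ℕ) : ℝ) * (Real.exp ‖A'‖ - 1)) < ρ) (X : PBond P j → (specialUnitaryLogChart (Fin N)).lie) (c : PBond P (j + 1)) :
    ((fderiv ℝ (fun (A : PBond P j → (specialUnitaryLogChart (Fin N)).lie) (c : PBond P (j + 1)) => (isChartRep_specialUnitaryGroup (n := Fin N)).logChart (avgFun (expMeanLogSU (n := Fin N)) (fun b => (isChartRep_specialUnitaryGroup (n := Fin N)).expChart (A b) * U₀ b) c * (avgFun (expMeanLogSU (n := Fin N)) U₀ c)⁻¹)) A' X c : (specialUnitaryLogChart (Fin N)).lie) : Matrix (Fin N) (Fin N) ℂ) =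
      fderiv ℂ (fun A : PBond P j → Matrix (Fin N) (Fin N) ℂ => mlog (eml (fun i : Idx P => ((walk (emb c.src) (loopWord P.L c.dir (off i.1) i.2.1 i.2.2)).map (fun s : LStep P j => if s.fwd then NormedSpace.exp (A s.bond) * ((U₀ s.bond : SU N) : Matrix (Fin N) (Fin N) ℂ) else star ((U₀ s.bond : SU N) : Matrix (Fin N) (Fin N) ℂ) * NormedSpace.exp (-(A s.bond)))).prod) * ((walk (emb c.src) (List.replicate P.L (c.dir, true))).map (fun s : LStep P j => if s.fwd then NormedSpace.exp (A s.bond) * ((U₀ s.bond : SU N) : Matrix (Fin N) (Fin N) ℂ) else star ((U₀ s.bond : SU N) : Matrix (Fin N) (Fin N) ℂ) * NormedSpace.exp (-(A s.bond)))).prod * star ((avgFun (expMeanLogSU (n := Fin N)) U₀ c : SU N) : Matrix (Fin N) (Fin N) ℂ))) (fun b => ((A' b : (specialUnitaryLogChart (Fin N)).lie) : Matrix (Fin N) (Fin N) ℂ)) (fun b => ((X b : (specialUnitaryLogChart (Fin N)).lie) : Matrix (Fin N) (Fin N) ℂ)) := by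
  set ψ := (fun (A : PBond P j → (specialUnitaryLogChart (Fin N)).lie) (c : PBond P (j + 1)) => (isChartRep_specialUnitaryGroup (n := Fin N)).logChart (avgFun (expMeanLogSU (n := Fin N)) (fun b => (isChartRep_specialUnitaryGroup (n := Fin N)).expChart (A b) * U₀ b) c * (avgFun (expMeanLogSU (n := Fin N)) U₀ c)⁻¹)) with hψ
  have hψd : DifferentiableAt ℝ ψ A' := differentiableAt_chartRead_of_polydisc U₀ hρ0 hρ hα hα4 A' hA'
  have hψc : ∀ c', DifferentiableAt ℝ (fun A => ψ A c') A' := fun c' =>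
    (differentiableAt_pi (𝕜 := ℝ) (Φ := ψ) (x := A')).1 hψd c'
  have hpi : fderiv ℝ ψ A' X c = fderiv ℝ (fun A => ψ A c) A' X := by
    have e := fderiv_pi (𝕜 := ℝ) (φ := fun (c' : PBond P (j + 1)) (A : PBond P j → (specialUnitaryLogChart (Fin N)).lie) => ψ A c') (x := A') hψc
    show fderiv ℝ (fun A c' => ψ A c') A' X c = _
    rw [e]; rfl
  rw [hpi, coe_fderiv_apply_eq (specialUnitaryLogChart (Fin N)).lie (hψc c) X]
  set ι : (PBond P j → (specialUnitaryLogChart (Fin N)).lie) →L[ℝ] (PBond P j → Matrix (Fin N) (Fin N) ℂ) :=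
    ContinuousLinearMap.pi fun b => ((specialUnitaryLogChart (Fin N)).lie).subtypeL.comp (ContinuousLinearMap.proj b) with hι
  have hιapp : ∀ Y : PBond P j → (specialUnitaryLogChart (Fin N)).lie, ι Y = fun b => ((Y b : (specialUnitaryLogChart (Fin N)).lie) : Matrix (Fin N) (Fin N) ℂ) := fun Y => rfl
  have heq : (fun A : PBond P j → (specialUnitaryLogChart (Fin N)).lie => ((ψ A c : (specialUnitaryLogChart (Fin N)).lie) : Matrix (Fin N) (Fin N) ℂ)) =ᶠ[𝓝 A']
      fun A => (fun B : PBond P j → Matrix (Fin N) (Fin N) ℂ => mlog (eml (fun i : Idx P => ((walk (emb c.src) (loopWord P.L c.dir (off i.1) i.2.1 i.2.2)).map (fun s : LStep P j => if s.fwd then NormedSpace.exp (B s.bond) * ((U₀ s.bond : SU N) : Matrix (Fin N) (Fin N) ℂ) else star ((U₀ s.bond : SU N) : Matrix (Fin N) (Fin N) ℂ) * NormedSpace.exp (-(B s.bond)))).prod) * ((walk (emb c.src) (List.replicate P.L (c.dir, true))).map (fun s : LStep P j => if s.fwd then NormedSpace.exp (B s.bond) * ((U₀ s.bond : SU N) :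 Matrix (Fin N) (Fin N) ℂ) else star ((U₀ s.bond : SU N) : Matrix (Fin N) (Fin N) ℂ) * NormedSpace.exp (-(B s.bond)))).prod * star ((avgFun (expMeanLogSU (n := Fin N)) U₀ c : SU N) : Matrix (Fin N) (Fin N) ℂ))) (ι A) := by
    have h := coe_chartRead_eventuallyEq_at U₀ c hρ0 hρ hα hα4 A' hA'
    simp only [hιapp]
    exact h
  rw [heq.fderiv_eq]
  have hA'' : 100 * ((((P.d + 2) * P.L : ℕ) : ℝ) * (Real.exp ‖ι A'‖ - 1)) ≤ ρ := by
    have hmono : Real.exp ‖ι A'‖ - 1 ≤ Real.exp ‖A'‖ - 1 := by rw [hιapp]; linarith [Real.exp_le_exp.2 (norm_coePi_le A')]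
    exact le_trans (by gcongr) hA'.le
  have hΦ : DifferentiableAt ℂ (fun B : PBond P j → Matrix (Fin N) (Fin N) ℂ => mlog (eml (fun i : Idx P => ((walk (emb c.src) (loopWord P.L c.dir (off i.1) i.2.1 i.2.2)).map (fun s : LStep P j => if s.fwd then NormedSpace.exp (B s.bond) * ((U₀ s.bond : SU N) : Matrix (Fin N) (Fin N) ℂ) else star ((U₀ s.bond : SU N) : Matrix (Fin N) (Fin N) ℂ) * NormedSpace.exp (-(B s.bond)))).prod) * ((walk (emb c.src) (List.replicate P.L (c.dir, true))).map (fun s : LStep P j => if s.fwd then NormedSpace.exp (B s.bond) * ((U₀ s.bond : SU N) : Matrix (Fin N) (Fin N) ℂ) else star ((U₀ s.bond : SU N) : Matrix (Fin N) (Fin N) ℂ) * NormedSpace.exp (-(B s.bond)))).prod * star ((avgFun (expMeanLogSU (n := Fin N)) U₀ c : SU N) : Matrix (Fin N) (Fin N) ℂ))) (ι A') :=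
    (analyticAt_cplxChartRead U₀ c hρ (hα c) hα4 (ι A') hA'').differentiableAt
  have hcomp := (hΦ.hasFDerivAt.restrictScalars ℝ).comp A' ι.hasFDerivAt
  rw [show (fun A : PBond P j → (specialUnitaryLogChart (Fin N)).lie => (fun B : PBond P j → Matrix (Fin N) (Fin N) ℂ => mlog (eml (fun i : Idx P => ((walk (emb c.src) (loopWord P.L c.dir (off i.1) i.2.1 i.2.2)).map (fun s : LStep P j => if s.fwd then NormedSpace.exp (B s.bond) * ((U₀ s.bond : SU N) : Matrix (Fin N) (Fin N) ℂ) else star ((U₀ s.bond : SU N) : Matrix (Fin N) (Fin N) ℂ) * NormedSpace.exp (-(B s.bond)))).prod) * ((walk (emb c.src) (List.replicate P.L (c.dir, true))).map (fun s : LStep P j => if s.fwd then NormedSpace.exp (B s.bond) * ((U₀ s.bond : SU N) : Matrix (Fin N) (Fin N) ℂ) else star ((U₀ s.bond : SU N) : Matrix (Fin N) (Fin N) ℂ) * NormedSpace.exp (-(B s.bond)))).prod * star ((avgFun (expMeanLogSU (n := Fin N)) U₀ c : SU N) : Matrix (Fin N) (Fin N) ℂ))) (ι A)) =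
      (fun B : PBond P j → Matrix (Fin N) (Fin N) ℂ => mlog (eml (fun i : Idx P => ((walk (emb c.src) (loopWord P.L c.dir (off i.1) i.2.1 i.2.2)).map (fun s : LStep P j => if s.fwd then NormedSpace.exp (B s.bond) * ((U₀ s.bond : SU N) : Matrix (Fin N) (Fin N) ℂ) else star ((U₀ s.bond : SU N) : Matrix (Fin N) (Fin N) ℂ) * NormedSpace.exp (-(B s.bond)))).prod) * ((walk (emb c.src) (List.replicate P.L (c.dir, true))).map (fun s : LStep P j => if s.fwd then NormedSpace.exp (B s.bond) * ((U₀ s.bond : SU N) : Matrix (Fin N) (Fin N) ℂ) else star ((U₀ s.bond : SU N) : Matrix (Fin N) (Fin N) ℂ) * NormedSpace.exp (-(B s.bond)))).prod * star ((avgFun (expMeanLogSU (n := Fin N)) U₀ c : SU N) : Matrix (Fin N) (Fin N) ℂ))) ∘ ι from rfl, hcomp.fderiv, ContinuousLinearMap.comp_apply,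
    ContinuousLinearMap.coe_restrictScalars', hιapp, hιapp]

end AtPoint

/-! ## §2 The Lipschitz letter: polydisc form, numeric form, `SU(2)` form -/

section Lipschitz

/-- Monotonicity of the Lipschitz bound in its three nonnegative factors. [folklore] -/
theorem lipBound_mono {B B' x x' y y' a : ℝ} (hB : 0 ≤ B) (hBB : B ≤ B') (hx : 0 ≤ x) (hxx : x ≤ x') (hy : 0 ≤ y) (hyy : y ≤ y') :
    32 * B * x * y / a ^ 2 ≤ 32 * B' * x' * y' / a ^ 2 := by
  apply div_le_div_of_nonneg_right _ (sq_nonneg a)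
  have h1 : B * x ≤ B' * x' := mul_le_mul hBB hxx hx (hB.trans hBB)
  have h2 : B * x * y ≤ B' * x' * y' := mul_le_mul h1 hyy hy ((mul_nonneg hB hx).trans h1)
  linarith

/-- ★★★ **THE ONE-STEP DERIVATIVE IS LIPSCHITZ ALONG THE CHART, POLYDISC FORM**: `0 < a`, `100ℓ(e^a − 1) ≤ ρ`, `‖A′‖ ≤ a∕8` ⟹
`‖↑((Dψ_{U₀}(A′) X) c) − ↑((Dψ_{U₀}(0) X) c)‖ ≤ 32·(54ℓ(e^a − 1))·‖X‖·‖A′‖∕a²`. [cite: Balaban1985Averaging, Prop. 4 (148)-(149) p.40] -/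
theorem norm_fderiv_chartRead_sub_fderiv_le {α ρ : ℝ} (hρ0 : 0 < ρ) (hρ : ρ ≤ innerRadius (specialUnitaryLogChart (Fin N)))
    (hα : ∀ c i, dist1 (loopHol U₀ c i) ≤ α) (hα4 : 4 * α ≤ ρ)
    {a : ℝ} (ha0 : 0 < a) (ha : 100 * ((((P.d + 2) * P.L : ℕ) : ℝ) * (Real.exp a - 1)) ≤ ρ)
    (A' : PBond P j → (specialUnitaryLogChart (Fin N)).lie) (hA' : ‖A'‖ ≤ a / 8) (X : PBond P j → (specialUnitaryLogChart (Fin N)).lie) (c : PBond P (j + 1)) :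
    ‖((fderiv ℝ (fun (A : PBond P j → (specialUnitaryLogChart (Fin N)).lie) (c : PBond P (j + 1)) => (isChartRep_specialUnitaryGroup (n := Fin N)).logChart (avgFun (expMeanLogSU (n := Fin N)) (fun b => (isChartRep_specialUnitaryGroup (n := Fin N)).expChart (A b) * U₀ b) c * (avgFun (expMeanLogSU (n := Fin N)) U₀ c)⁻¹)) A' X c : (specialUnitaryLogChart (Fin N)).lie) : Matrix (Fin N) (Fin N) ℂ) - ((fderiv ℝ (fun (A : PBond P j → (specialUnitaryLogChart (Fin N)).lie) (c : PBond P (j + 1)) => (isChartRep_specialUnitaryGroup (n := Fin N)).logChart (avgFun (expMeanLogSU (n := Fin N)) (fun b => (isChartRep_specialUnitaryGroup (n := Fin N)).expChart (A b) * U₀ b) c * (avgFun (expMeanLogSU (n := Fin N)) U₀ c)⁻¹)) 0 X c : (specialUnitaryLogChart (Fin N)).lie) : Matrix (Fin N) (Fin N) ℂ)‖ ≤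
      32 * (54 * ((((P.d + 2) * P.L : ℕ) : ℝ) * (Real.exp a - 1))) * ‖X‖ * ‖A'‖ / a ^ 2 := by
  have hA'lt : 100 * ((((P.d + 2) * P.L : ℕ) : ℝ) * (Real.exp ‖A'‖ - 1)) < ρ := by
    have hlt : ‖A'‖ < a := by linarith [norm_nonneg A']
    have hℓ0 : (0 : ℝ) < (((P.d + 2) * P.L : ℕ) : ℝ) := by exact_mod_cast Nat.pos_of_ne_zero (Nat.mul_ne_zero (by omega) P.L_pos.ne')
    have hmono : Real.exp ‖A'‖ - 1 < Real.exp a - 1 := by linarith [Real.exp_lt_exp.2 hlt]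
    calc 100 * ((((P.d + 2) * P.L : ℕ) : ℝ) * (Real.exp ‖A'‖ - 1)) < 100 * ((((P.d + 2) * P.L : ℕ) : ℝ) * (Real.exp a - 1)) := by gcongr
      _ ≤ ρ := ha
  rw [coe_fderiv_chartRead_apply_eq_at U₀ hρ0 hρ hα hα4 A' hA'lt X c, coe_fderiv_chartRead_apply_eq U₀ hρ hα hα4 hρ0 X c]
  have hXh : ‖(fun b => ((X b : (specialUnitaryLogChart (Fin N)).lie) : Matrix (Fin N) (Fin N) ℂ))‖ ≤ ‖X‖ := norm_coePi_le X
  have hAh : ‖(fun b => ((A' b : (specialUnitaryLogChart (Fin N)).lie) : Matrix (Fin N) (Fin N) ℂ))‖ ≤ ‖A'‖ := norm_coePi_le A'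
  have h := norm_fderiv_cplxChartRead_sub_le U₀ c hρ (hα c) hα4 ha0 ha (fun b => ((A' b : (specialUnitaryLogChart (Fin N)).lie) : Matrix (Fin N) (Fin N) ℂ)) (hAh.trans hA') (fun b => ((X b : (specialUnitaryLogChart (Fin N)).lie) : Matrix (Fin N) (Fin N) ℂ))
  have hB0 : 0 ≤ 54 * ((((P.d + 2) * P.L : ℕ) : ℝ) * (Real.exp a - 1)) := by
    have : 0 ≤ Real.exp a - 1 := by linarith [Real.add_one_le_exp a]
    positivity
  exact h.trans (lipBound_mono hB0 le_rfl (norm_nonneg _) hXh (norm_nonneg _) hAh)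

/-- ★★★ **(148)–(149) AT ONE STEP FOR THE TREE's `ψ`, NUMERIC FORM** (`a := ρ∕(200ℓ)`): `‖A′‖ ≤ ρ∕(1600·ℓ)` ⟹
**`‖↑((Dψ_{U₀}(A′) X) c) − ↑((Dψ_{U₀}(0) X) c)‖ ≤ (691200∕ρ)·ℓ²·‖A′‖·‖X‖`**. [cite: Balaban1985Averaging, Prop. 4 (148)-(149) p.40] -/
theorem norm_fderiv_chartRead_sub_fderiv_le_of_norm_le {α ρ : ℝ} (hρ0 : 0 < ρ) (hρ : ρ ≤ innerRadius (specialUnitaryLogChart (Fin N)))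
    (hα : ∀ c i, dist1 (loopHol U₀ c i) ≤ α) (hα4 : 4 * α ≤ ρ)
    (A' : PBond P j → (specialUnitaryLogChart (Fin N)).lie) (hA' : ‖A'‖ ≤ ρ / (1600 * (((P.d + 2) * P.L : ℕ) : ℝ))) (X : PBond P j → (specialUnitaryLogChart (Fin N)).lie) (c : PBond P (j + 1)) :
    ‖((fderiv ℝ (fun (A : PBond P j → (specialUnitaryLogChart (Fin N)).lie) (c : PBond P (j + 1)) => (isChartRep_specialUnitaryGroup (n := Fin N)).logChart (avgFun (expMeanLogSU (n := Fin N)) (fun b => (isChartRep_specialUnitaryGroup (n := Fin N)).expChart (A b) * U₀ b) c * (avgFun (expMeanLogSU (n := Fin N)) U₀ c)⁻¹)) A' X c : (specialUnitaryLogChart (Fin N)).lie) : Matrix (Fin N) (Fin N) ℂ) - ((fderiv ℝ (fun (A : PBond P j → (specialUnitaryLogChart (Fin N)).lie) (c : PBond P (j + 1)) => (isChartRep_specialUnitaryGroup (n := Fin N)).logChart (avgFun (expMeanLogSU (n := Fin N)) (fun b => (isChartRep_specialUnitaryGroup (n := Fin N)).expChart (A b) * U₀ b) c * (avgFun (expMeanLogSU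 (n := Fin N)) U₀ c)⁻¹)) 0 X c : (specialUnitaryLogChart (Fin N)).lie) : Matrix (Fin N) (Fin N) ℂ)‖ ≤
      691200 / ρ * (((P.d + 2) * P.L : ℕ) : ℝ) ^ 2 * ‖A'‖ * ‖X‖ := by
  have hℓ1 : (1 : ℝ) ≤ (((P.d + 2) * P.L : ℕ) : ℝ) := by exact_mod_cast Nat.one_le_iff_ne_zero.2 (Nat.mul_ne_zero (by omega) P.L_pos.ne')
  have hρ3 : ρ ≤ 1 / 3 := hρ.trans innerRadius_le_third
  set a : ℝ := ρ / (200 * (((P.d + 2) * P.L : ℕ) : ℝ)) with ha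
  have ha0 : 0 < a := by rw [ha]; positivity
  have ha1 : a ≤ 1 := by rw [ha, div_le_one (by positivity)]; linarith
  have hea : Real.exp a - 1 ≤ 2 * a := by
    have h3 := Real.abs_exp_sub_one_sub_id_le (x := a) (by rw [abs_of_nonneg ha0.le]; exact ha1)
    have h4 : Real.exp a - 1 - a ≤ a ^ 2 := (le_abs_self _).trans h3
    nlinarith
  have hcond : 100 * ((((P.d + 2) * P.L : ℕ) : ℝ) * (Real.exp a - 1)) ≤ ρ := by
    calc 100 * ((((P.d + 2) * P.L : ℕ) : ℝ) * (Real.exp a - 1)) ≤ 100 * ((((P.d + 2) * P.L : ℕ) : ℝ) * (2 * a)) := by gcongr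
      _ = ρ := by rw [ha]; field_simp; norm_num
  have hA8 : ‖A'‖ ≤ a / 8 := by
    rw [ha]; rw [div_div, show (200 : ℝ) * (((P.d + 2) * P.L : ℕ) : ℝ) * 8 = 1600 * (((P.d + 2) * P.L : ℕ) : ℝ) by ring]; exact hA'
  have h := norm_fderiv_chartRead_sub_fderiv_le U₀ hρ0 hρ hα hα4 ha0 hcond A' hA8 X c
  have hB0 : 0 ≤ 54 * ((((P.d + 2) * P.L : ℕ) : ℝ) * (Real.exp a - 1)) := by
    have : 0 ≤ Real.exp a - 1 := by linarith [Real.add_one_le_exp a]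
    positivity
  have hBB : 54 * ((((P.d + 2) * P.L : ℕ) : ℝ) * (Real.exp a - 1)) ≤ 54 * ((((P.d + 2) * P.L : ℕ) : ℝ) * (2 * a)) := by
    have hℓ0 : (0 : ℝ) ≤ (((P.d + 2) * P.L : ℕ) : ℝ) := Nat.cast_nonneg _
    nlinarith
  have h2 := h.trans (lipBound_mono hB0 hBB (norm_nonneg _) le_rfl (norm_nonneg _) le_rfl)
  have heq : 32 * (54 * ((((P.d + 2) * P.L : ℕ) : ℝ) * (2 * a))) * ‖X‖ * ‖A'‖ / a ^ 2 = 691200 / ρ * (((P.d + 2) * P.L : ℕ) : ℝ) ^ 2 * ‖A'‖ * ‖X‖ := by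
    rw [ha]; field_simp; ring
  linarith

/-- ★★★ **(148)–(149) AT ONE STEP ON `SU(2)`**: guard `dist1 (loopHol U₀ c i) ≤ α ≤ 1∕12` at every coarse bond, `‖A′‖ ≤ 1∕(4800·ℓ)` ⟹
**`‖↑((Dψ_{U₀}(A′) X) c) − ↑((Dψ_{U₀}(0) X) c)‖ ≤ 2073600·ℓ²·‖A′‖·‖X‖`** (`ρ = innerRadius = 1∕3`). [cite: Balaban1985Averaging, Prop. 4 (148)-(149) p.40] -/
theorem norm_fderiv_chartRead_sub_fderiv_le_SU2 (U₀ : GaugeField P j (SU 2)) {α : ℝ} (hα : ∀ c i, dist1 (loopHol U₀ c i) ≤ α) (hα12 : α ≤ 1 / 12)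
    (A' : PBond P j → (specialUnitaryLogChart (Fin 2)).lie) (hA' : ‖A'‖ ≤ 1 / (4800 * (((P.d + 2) * P.L : ℕ) : ℝ))) (X : PBond P j → (specialUnitaryLogChart (Fin 2)).lie) (c : PBond P (j + 1)) :
    ‖((fderiv ℝ (fun (A : PBond P j → (specialUnitaryLogChart (Fin 2)).lie) (c : PBond P (j + 1)) => (isChartRep_specialUnitaryGroup (n := Fin 2)).logChart (avgFun (expMeanLogSU (n := Fin 2)) (fun b => (isChartRep_specialUnitaryGroup (n := Fin 2)).expChart (A b) * U₀ b) c * (avgFun (expMeanLogSU (n := Fin 2)) U₀ c)⁻¹)) A' X c : (specialUnitaryLogChart (Fin 2)).lie) : Matrix (Fin 2) (Fin 2) ℂ) - ((fderiv ℝ (fun (A : PBond P j → (specialUnitaryLogChart (Fin 2)).lie) (c : PBond P (j + 1)) => (isChartRep_specialUnitaryGroup (n := Fin 2)).logChart (avgFun (expMeanLogSU (n := Fin 2)) (fun b => (isChartRep_specialUnitaryGroup (n := Fin 2)).expChart (A b) * U₀ b) c * (avgFun (expMeanLogSU (n := Fin 2)) U₀ c)⁻¹)) 0 X c : (specialUnitaryLogChart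 (Fin 2)).lie) : Matrix (Fin 2) (Fin 2) ℂ)‖ ≤
      2073600 * (((P.d + 2) * P.L : ℕ) : ℝ) ^ 2 * ‖A'‖ * ‖X‖ := by
  have hρ : (1 / 3 : ℝ) ≤ innerRadius (specialUnitaryLogChart (Fin 2)) := by
    unfold innerRadius; rw [specialUnitaryLogChart_ρ, Fintype.card_fin]; norm_num
  have hA'' : ‖A'‖ ≤ (1 / 3) / (1600 * (((P.d + 2) * P.L : ℕ) : ℝ)) := by rw [div_div]; convert hA' using 2; ring
  have h := norm_fderiv_chartRead_sub_fderiv_le_of_norm_le U₀ (by norm_num) hρ hα (by linarith) A' hA'' X c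
  calc _ ≤ 691200 / (1 / 3) * (((P.d + 2) * P.L : ℕ) : ℝ) ^ 2 * ‖A'‖ * ‖X‖ := h
    _ = 2073600 * (((P.d + 2) * P.L : ℕ) : ℝ) ^ 2 * ‖A'‖ * ‖X‖ := by norm_num

end Lipschitz

end Summit.QuantumFields.YangMills.Theorems.FluctuationComparisonRegPrIntLS2BetaChartReadDerivLipschitz

end
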